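import Mathlib

/-!
# LevelFloorCurve — the R2 amplitude floor in (η, κ) coordinates (FLUID COMPUTER cell, idea-1 gen 7)

HONEST FRAMING: low prior, high value-of-information experiment on Tao's machine paradigm;
NOT a claim that NS blows up.

Dictionary (cell files PREREG-R2.md §10i, PREREG-R2-READING.md §8o): for one level of the machine
with scale ratio `λ > 1`, transferred energy fraction `η = E_out / E_in > 0` and sup-velocity gain
`G = U_out / U_in`, the cell's *concentration exponent* is `κ := 2 log_λ (G / √η)` (so that
`G = √η · λ^(κ/2)`), and the level ratio of the amplitude rung is `r = G / λ = √η · λ^(κ/2 - 1)`.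
The amplitude floor `r ≥ 1` (tree: `LevelRatioFloor.level_ratio_frequently_gt'`) is, in these
coordinates, the curve `κ ≥ κ_floor(η) := 2 - log_λ η`; the cell's census (READING §8o addendum 4)
reports `κ(t) ≤ 0.474 · κ_floor(λ, η(t))` at every clean instant of 222 trajectories.  This file pins
the algebra (hedged dictionary, pure real analysis, no fluid content) so that the two forms of the
floor used by the readers cannot drift apart: `r ≥ 1 ↔ κ ≥ κ_floor`, and a fractional bound
`κ ≤ θ κ_floor` with `θ < 1`, `κ_floor > 0` keeps the level strictly below the floor.

Provenance: written by planner-pub-fluidc-idea-1-g7-0 (HOME/pub-fluidc-idea-1/lean/LevelFloorCurve.lean,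
sha16 c6ceb389a8870a1a); filed through the gate by pub-fluidc-lit gen 36 at idea-1's ASK (STATUS
2026-08-23T04:02Z), with one docstring added (`sqrt_eq_rpow_logb`) and nothing else changed.
-/

namespace Summit.NavierStokesRegularity.FluidComputer.LevelFloorCurve

/-- The level ratio in `(η, κ)` coordinates: `r = √η · λ^(κ/2 - 1)`. -/
noncomputable def levelRatio (lam η κ : ℝ) : ℝ := Real.sqrt η * lam ^ (κ / 2 - 1)

/-- The floor curve `κ_floor(η) = 2 - log_λ η`. -/
noncomputable def kappaFloor (lam η : ℝ) : ℝ := 2 - Real.logb lam η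

/-- `√η = λ^(log_λ η / 2)` for `λ > 1`, `η > 0`. -/
theorem sqrt_eq_rpow_logb {lam η : ℝ} (hlam : 1 < lam) (hη : 0 < η) :
    Real.sqrt η = lam ^ (Real.logb lam η / 2) := by
  have hlam0 : 0 < lam := by linarith
  have hlam1 : lam ≠ 1 := ne_of_gt hlam
  rw [Real.sqrt_eq_rpow, show Real.logb lam η / 2 = Real.logb lam η * (1 / 2) by ring,
    Real.rpow_mul hlam0.le, Real.rpow_logb hlam0 hlam1 hη]

/-- `r = λ^((κ - κ_floor)/2)`. -/
theorem levelRatio_eq_rpow {lam η : ℝ} (hlam : 1 < lam) (hη : 0 < η) (κ : ℝ) :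
    levelRatio lam η κ = lam ^ ((κ - kappaFloor lam η) / 2) := by
  have hlam0 : 0 < lam := by linarith
  unfold levelRatio kappaFloor
  rw [sqrt_eq_rpow_logb hlam hη, ← Real.rpow_add hlam0]
  congr 1
  ring

/-- THE FLOOR CURVE: `r ≥ 1 ↔ κ ≥ κ_floor(η)`. -/
theorem one_le_levelRatio_iff {lam η : ℝ} (hlam : 1 < lam) (hη : 0 < η) (κ : ℝ) :
    1 ≤ levelRatio lam η κ ↔ kappaFloor lam η ≤ κ := by
  rw [levelRatio_eq_rpow hlam hη, ← Real.rpow_zero lam, Real.rpow_le_rpow_left_iff hlam]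
  constructor <;> intro h <;> linarith

/-- Strict version: `r > 1 ↔ κ > κ_floor(η)`. -/
theorem one_lt_levelRatio_iff {lam η : ℝ} (hlam : 1 < lam) (hη : 0 < η) (κ : ℝ) :
    1 < levelRatio lam η κ ↔ kappaFloor lam η < κ := by
  rw [levelRatio_eq_rpow hlam hη, ← Real.rpow_zero lam, Real.rpow_lt_rpow_left_iff hlam]
  constructor <;> intro h <;> linarith

/-- Monotone reading of the census: a bound `κ ≤ θ · κ_floor` with `θ < 1` and `κ_floor > 0`
keeps the level strictly below the floor. -/
theorem levelRatio_lt_one_of_fraction {lam η κ θ : ℝ} (hlam : 1 < lam) (hη : 0 < η)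
    (hfloor : 0 < kappaFloor lam η) (hθ : θ < 1) (hκ : κ ≤ θ * kappaFloor lam η) :
    levelRatio lam η κ < 1 := by
  have hlt : θ * kappaFloor lam η < 1 * kappaFloor lam η := mul_lt_mul_of_pos_right hθ hfloor
  rw [levelRatio_eq_rpow hlam hη, ← Real.rpow_zero lam, Real.rpow_lt_rpow_left_iff hlam]
  linarith

/-- `κ_floor > 0` whenever `η < λ²` — in particular for every `η ≤ 1`. -/
theorem kappaFloor_pos {lam η : ℝ} (hlam : 1 < lam) (hη : 0 < η) (hηlam : η < lam ^ (2 : ℝ)) :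
    0 < kappaFloor lam η := by
  unfold kappaFloor
  have h : Real.logb lam η < 2 := by
    rw [Real.logb_lt_iff_lt_rpow hlam hη]
    exact hηlam
  linarith

/-- Sanity instance of the dictionary: at `λ = 2`, `η = 1/4` the floor asks for `κ ≥ 4`. -/
example : kappaFloor 2 (1 / 4) = 4 := by
  unfold kappaFloor
  have h4 : (1 / 4 : ℝ) = ((2 : ℝ) ^ (2 : ℝ))⁻¹ := by
    rw [Real.rpow_two]; norm_num
  rw [h4, Real.logb_inv, Real.logb_rpow (by norm_num) (by norm_num)]
  norm_num

end Summit.NavierStokesRegularity.FluidComputer.LevelFloorCurve
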